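import Summits.BirchSwinnertonDyer.BirchSwinnertonDyer.Theses.CumulativeHeegnerLeopoldt
import Summits.BirchSwinnertonDyer.BirchSwinnertonDyer.Theorems.CumulativeHeegnerLeopoldtEisensteinCharacterInvariantsAtThreeCharacterCutCore
import Summits.BirchSwinnertonDyer.BirchSwinnertonDyer.Theorems.CumulativeHeegnerLeopoldtEisensteinCharacterInvariantsAtThreeLocThree
import Summits.BirchSwinnertonDyer.BirchSwinnertonDyer.Theorems.CumulativeHeegnerLeopoldtEisensteinCharacterInvariantsAtThreeStubAlgebraicLambdaMuZeroOfPrint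
import Summits.BirchSwinnertonDyer.BirchSwinnertonDyer.Theorems.CumulativeHeegnerLeopoldtEisensteinCharacterInvariantsAtThreeAlgSplit
import Summits.BirchSwinnertonDyer.BirchSwinnertonDyer.Theorems.CumulativeHeegnerLeopoldtEisensteinCharacterInvariantsAtThreeRamifiedSplit
import Summits.BirchSwinnertonDyer.BirchSwinnertonDyer.Theorems.CumulativeHeegnerLeopoldtEisensteinCharacterInvariantsAtThreeRamifiedResidualOfPrint
import Literature.NumberTheory.EllipticCurves.CastellaGrossiLeeSkinner2022.KatzPAdicLFunctionExistence
import Summits.BirchSwinnertonDyer.BirchSwinnertonDyer.Theorems.CumulativeHeegnerLeopoldtEisensteinCharacterInvariantsAtThreeAlgLambdaDoor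
import Summits.BirchSwinnertonDyer.BirchSwinnertonDyer.Theorems.CumulativeHeegnerLeopoldtEisensteinCharacterInvariantsAtThreeStubCurveRelaxationCorankEq
import Summits.BirchSwinnertonDyer.BirchSwinnertonDyer.Theorems.CumulativeHeegnerLeopoldtEisensteinCharacterInvariantsAtThreeStubCurveLocalCorankGe
import Summits.BirchSwinnertonDyer.BirchSwinnertonDyer.Theorems.CumulativeHeegnerLeopoldtEisensteinCharacterInvariantsAtThreeCharacterCutCoreOfPrint
import Summits.BirchSwinnertonDyer.BirchSwinnertonDyer.Theorems.EisensteinPrimesResidualCharacterSelmerFiniteOfFact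
import Summits.BirchSwinnertonDyer.BirchSwinnertonDyer.Theorems.CumulativeHeegnerLeopoldtEisensteinCharacterInvariantsAtThreeAlgLambdaOfCGLS
import HarnessLib

/-!
# Crux `EisensteinCharacterInvariantsAtThreeOdd` (stmt-BirchSwinnertonDyer-23970) of route `CumulativeHeegnerLeopoldt` — LINE `birth`, v12 CANDIDATE
# (leafhand `leafhand-bsd-cumulativeheegnerl-1` g0, NOT registered — for the LEAD: v11 with the PRINT stub ALG-PRINT cut from 7 to 3 conjuncts)

v12 CANDIDATE (this file; the registered skeleton stays v11 76d2d6d28fe42776 until a LEAD re-registers): `stub_algLambdaPrintedFacts` := CGLS 2022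
Prop. 1.2.5 (module clause) ∧ Cor. 1.2.6 (i) ∧ Cor. 1.2.6 (ii) ONLY — Greenberg 2016 Props. 4.1.1 / 2.6.3 and Greenberg 2006 Props. 4.1 / 3.2 are fed by
TREE THEOREMS through the leafhand's landed helpers `…CurveRelaxationOfTree` (p794298: [ALG-≥(i)] ⟸ Prop. 14), `…AlgLambdaDoorOfCGLS` (p794640:
the door ⟸ 4 CGLS facts) and `…AlgLambdaOfCGLS` ([ALG-λ]/[ALG] ⟸ 3 CGLS facts; Prop. 14 ⟸ Prop. 1.2.5); `curveRelaxationCorankGe` and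
`stub_algLambdaFormula` below are re-fed from those; every other line of v11 is byte-identical. Sorries: the same three stub names.

# (v11 header follows)
# LINE `birth`, v11
# (= line `birth` v5 a938f29ff5eb8691 of the banked ∀-d_K crux 24199, lead bsd-line-chl-p1 g9, MINUS the scope-residue stub
# EVEN; re-registered on the odd-d_K cut 23970 by lead bsd-line-chl-p1 g10. v1 = BC3 skeleton 7ff6adfe04f0 of pen pss3 g10 /
# lead chl-p1 g0 (stubs A/B/C); v2–v5 = the CHARACTER CUT of leads g7–g9.)

Route rev 7 (pen pss3 g21) restated K2 with the binder `Odd (NumberField.discr K)` inserted after the Heegner hypothesis —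
exactly the statement v5's `eisensteinCharacterInvariantsAtThree_odd` already concludes — and rev 9/11 PROMOTED v5's research
stub `stub_anCongruenceCore` to the crux item stmt-BirchSwinnertonDyer-24040 `EisensteinCongruenceCoreAtThree` (signature
byte-identical to the stub below). So v6 = v5 with `stub_evenDiscriminant` deleted and the composition
`EisensteinCharacterInvariantsAtThreeOdd_of := eisensteinCharacterInvariantsAtThree_odd`. v7 (lead chl-p1 g10) RESHAPES the port stub
[ALG-λ]: `stub_algLambdaFormula` is now a THEOREM from the new PRINT stub `stub_algLambdaPrintedFacts` (seven published facts of
CGLS 2022 / Greenberg 2006, 2016 by name) and the new PORT stub `stub_curveRelaxationCorankGe` (the `≥` half of the curve-side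
relaxation count, Greenberg–Vatsal Prop. 2.4 / Pollack–Weston Prop. A.2 for `E[3^∞]` over `K_∞^{ac}`), through
`EisensteinCharacterInvariantsAtThreeAlgLambdaDoor.formula_of_facts_of_corankGe` (p705629). v8 (g10) splits the port stub ALG-≥ into
its two printed ingredients: ALG-≥(i) the relaxation COUNT (surjectivity of the global-to-local map, PW Prop. A.2) and ALG-≥(ii) the
LOCAL lower bound (GV Prop. 2.4 at a multiplicative place). v9: ALG-≥(i) is a THEOREM (p707562). v10: ALG-≥(ii) is a THEOREM
(p708936) — the whole algebraic λ-formula [ALG-λ] now rests on PRINT facts only. v11 (g10) RESHAPES the character branches: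
BR1 `stub_charMainConjOnTree : CharMainConjOnTree 3` (claim-tagged, K5 shape) is DELETED and BRr-λ `stub_ramifiedBranchLambda`
becomes a THEOREM — both from the new PRINT stub `stub_katzRubinPrintedFacts` (CGLS 2022 Thm. 2.1.2 ∧ Thm. 1.2.2 + Rubin's
`λ`-clause ×2, the tree's Literature named facts `thm212_exists_isKatzLFunction`, `thm122_fe_omegaPartner_…`, `thm122_charGrDual_…`),
because on the Leopoldt cell both members of the pair are in the printed regime `θ|_{G_v̄} ∉ {𝟙, ω}`
(`EisensteinCharacterInvariantsAtThreeBranchesOfPrint`, `…CharacterCutCoreOfPrint`); and v3's PRINT stub `stub_printedInputs`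
(CGLS Prop. 14 ∧ Thm. 2.1.2) becomes a THEOREM too, Prop. 14 following IN THE KERNEL from Prop. 1.2.5's module clause
(`TeichmullerPairUnramifiedAtMult.prop14_residualCharacterSelmer_finite_of_fact`). After v11 the crux K2-odd rests on TEN PUBLISHED
named facts (2 PRINT stubs) + ONE research statement (stub AN = crux 24040). Stubs (3, sorried):

* ALG-PRINT `stub_algLambdaPrintedFacts` — the seven published facts the door half of the λ-formula consumes, by name:
      CGLS 2022 Prop. 1.2.5 (module clause), Cor. 1.2.6 (i) global lift, (ii) local surjectivity; Greenberg 2016 Props. 4.1.1,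
      2.6.3; Greenberg 2006 Props. 4.1, 3.2 (Prop. 4.2 and §5 A are tree theorems; Prop. 14 follows from Prop. 1.2.5, v11).
* AN  `stub_anCongruenceCore` — = crux ITEM stmt-BirchSwinnertonDyer-24040 `EisensteinCongruenceCoreAtThree` (r301,
      vetted 2026-08-29T03:48Z) VERBATIM: the ADDITIVE twin of `KellerYin2024.thm222_anacong_goodLattice_of_ne_one`
      (CGLS Thms. 2.2.1/2.2.2 with (2.16)) in CORE form — GIVEN the first-unit index `nφ` of the Katz frame `L_φ`,
      `μ(L) = 0` and `λ(L) + Σ λ𝒫_w(f) = 2·nφ + Σ(…)`: the Λ-adic Eisenstein congruence `ℒ_𝔭 ≡ 𝓔·L_φ·L_ψ` for the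
      born-depleted BDP measure at `27 ∣ N`, Katz's functional equation, Euler bookkeeping. NOT PRINTED at `p² ∣ N` —
      the ONE research statement of the line (hardest stub; its own crux item, no prover work inside this line).
* KR-PRINT `stub_katzRubinPrintedFacts` (v11) — CGLS 2022 Thm. 2.1.2 (the anticyclotomic Katz `p`-adic `L`-function exists:
      `thm212_exists_isKatzLFunction`) ∧ Thm. 1.2.2 (Rubin, Hida) + Rubin's `λ`-clause + (2.16) for the `ω`-partner
      (`thm122_fe_omegaPartner_charGrDual_torsion_muZero_lambda_eq`) ∧ its `φ`-half (`thm122_charGrDual_torsion_muZero_firstUnit_lambda_eq`)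
      — character level / analytic, PUBLISHED, `E`-blind. Closes only by formalising the prints (Katz; Rubin's two-variable IMC; Katz's
      functional equation; Hida's `μ = 0`).

FORMER STUBS, now THEOREMS of the tree (kept under their stub names so the composition is unchanged) or DELETED:
* PRINT `stub_printedInputs` (CGLS Prop. 14 ∧ Thm. 2.1.2) — THEOREM (v11) ⟸ ALG-PRINT (i) ∧ KR-PRINT (i)
      (`prop14_residualCharacterSelmer_finite_of_fact`); still re-exported as `stub_residualCharacterSelmerFinite` / `stub_katzLFunctionExists`.
* BRr-λ `stub_ramifiedBranchLambda` — THEOREM (v11) ⟸ KR-PRINT (ii) (`…BranchesOfPrint.ramifiedBranchLambda_of_print`):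
      `λ(𝔛_{θram}) = λ(L_φ)`, Rubin's IMC at `θram` through the functional equation (CGLS Thm. 1.2.2 with (2.16)).
* BR1 `stub_charMainConjOnTree : CharMainConjOnTree 3` — DELETED (v11): the cut now consumes KR-PRINT (iii) at the 3-unramified member
      (`…CharacterCutCoreOfPrint`, regime clauses from the cell), so the claim-tagged K5 shape is no longer an input of this line.
* ALG-≥(i) `stub_curveRelaxationCorankEq` — PROVED (p707562): `corank_{ℤ_3}(Sel_{𝔭′}^{Sf′}/Sel_{𝔭′}^∅)(E_K) = Σ_{w∈Sf′} [Γ:Γ_w]·corank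
      H¹(K_{∞,w}, E[3^∞])` GRANTED Greenberg 2016 Prop. 2.6.3, Greenberg 2006 Props. 4.1/3.2 and CGLS Prop. 14 by name (bsd-eis's
      twist-deformation road at `S₀ = Sf′` + kernel + additivity);
* ALG-≥(ii) `stub_curveLocalCorankGe` — PROVED (p708936, `EisensteinCharacterInvariantsAtThreeCurveLocalCorank.stub_curveLocalCorankGe`,
      on `CurveLocalTameCorank` p708556: Tate-curve dévissage + `cd_3 ≤ 1` + the unramified count): `mult_{X=(Nw)⁻¹} P̃_w(E_K) ≤
      corank H¹(K_{∞,w}, E[3^∞])` for `w ∈ Sf′`; with ALG-≥(i) it gives v7's `stub_curveRelaxationCorankGe` (theorem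
      `curveRelaxationCorankGe`), whence [ALG-λ]. The `≤` half of the count is the tree's `FSideCorankLeOffP`.

THEOREMS in this skeleton: `curveRelaxationCorankGe` (v7 stub ALG-≥) ⟸ P ∧ ALG-PRINT ∧ ALG-≥(i) ∧ ALG-≥(ii) (v8);
`stub_algLambdaFormula` (v3–v6 stub ALG-λ) ⟸ P ∧ ALG-PRINT ∧ ALG-≥ (p705629, v7);
`stub_algebraicLambdaMuZero` (v1 stub A) ⟸ P (p680949); BRr-R
`stub_printedInputs` (P) ⟸ ALG-PRINT ∧ KR-PRINT (v11); `stub_ramifiedResidualFinite` ⟸ P (p687701); `stub_ramifiedBranchLambda` ⟸ KR-PRINT (v11); `stub_ramifiedBranch` ⟸ BRr-R ∧ BRr-λ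
(p686413); `stub_algLambda` ⟸ P ∧ ALG (p684853); [TOR] (p681358) and [LOC₃] (p682321) are tree theorems consumed by the cut;
`eisensteinCharacterInvariantsAtThree_odd` = K2 at odd `d_K` ⟸ P ∧ ALG ∧ AN ∧ BRr ∧ KR-PRINT ∧ F1b (core cut with [BR𝟙] from print,
`…CharacterCutCoreOfPrint`); `EisensteinCharacterInvariantsAtThreeOdd_of` concludes the route decl BY NAME. Sorries only in `stub_*`.
BSD is not proved by any of this.
-/

set_option linter.dupNamespace false
set_option autoImplicit false

noncomputable section

open scoped Classical

namespace Summit.BirchSwinnertonDyer.BirchSwinnertonDyer.Cruxes.EisensteinCharacterInvariantsAtThreeOdd.Birth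

-- the opens under which the binder types of p614352 / p681722 were written (stub signatures VERBATIM in that currency)
open PowerSeries WeierstrassCurve NumberField IsDedekindDomain Field
  Literature.NumberTheory.EllipticCurves Literature.NumberTheory.EllipticCurves.ModularForms
  Literature.NumberTheory.EllipticCurves.Rank1Residual
  Literature.NumberTheory.EllipticCurves.KellerYin2024
  Literature.NumberTheory.GaloisRepresentations
  Summit.BirchSwinnertonDyer.Rank1Residual
  Summit.BirchSwinnertonDyer.Rank1Residual.X1.KellerYinMuLambdaSplit
  Summit.BirchSwinnertonDyer.BirchSwinnertonDyer.Theorems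

/-! ## The three registered stubs of v11 (+ the former stubs ALG-≥(i), ALG-≥(ii), now theorems) -/

/-- STUB ALG-PRINT, v12 CANDIDATE (THREE Literature named facts, conjoined — PRINT inputs, open until formalised): Castella–Grossi–Lee–Skinner
2022 Prop. 1.2.5 (module clause: Rubin 1991 + Hida 2010 for the character Selmer duals), Cor. 1.2.6 (i) (global lift of residual Selmer classes)
and (ii) (local surjectivity at `v̄`). v11's further four conjuncts (Greenberg 2016 Props. 4.1.1, 2.6.3; Greenberg 2006 Props. 4.1, 3.2) are fed
by tree theorems through `…AlgLambdaOfCGLS` / `…AlgLambdaDoorOfCGLS` / `…CurveRelaxationOfTree` (leafhand-chl-1 g0); CGLS Prop. 14 ⟸ conjunct 1. -/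
theorem stub_algLambdaPrintedFacts :
    Literature.NumberTheory.EllipticCurves.CastellaGrossiLeeSkinner2022.prop125_characterGrSelmerDual_torsion_muZero_dim ∧
      Literature.NumberTheory.EllipticCurves.CastellaGrossiLeeSkinner2022.cor126_residualCharacter_globalLift ∧
      Literature.NumberTheory.EllipticCurves.CastellaGrossiLeeSkinner2022.cor126_residualCharacter_localSurjective := by
  sorry

/-- v8 STUB ALG-≥(i), now a THEOREM (p707562, lead chl-p1 g10): the curve-side RELAXATION COUNT on the Leopoldt cell — for every `Sf′` = the places of `K` over `N`
prime to `3`, `corank_{ℤ_3}(Sel_{𝔭′}^{Sf′}(K_∞, E[3^∞]) / Sel_{𝔭′}^∅(K_∞, E[3^∞])) = Σ_{w∈Sf′} [Γ:Γ_w] · corank_{ℤ_3} H¹(K_{∞,w}, E[3^∞])`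
(Castella's Selmer groups, X11b currency; `[Γ:Γ_w] = numPlacesAbove κ w`; the local group read at the chosen decomposition group
`ker κ ⊓ D_w`). In print: the surjectivity of the global-to-local map (Pollack–Weston 2011 Prop. A.2 / CGLS (eq:1) / GV Cor. (2.3)),
here GRANTED Greenberg 2016 Prop. 2.6.3 and Greenberg 2006 Props. 4.1, 3.2 BY NAME (the antecedents; Prop. 4.2 and §5 A are tree
theorems) and CGLS Prop. 14 (for the `Λ`-cotorsion of `X_ac^∅`, through B1): bsd-eis's twist-deformation road for `E[p^∞]`
(`AcTwistDeformation.primaryTorsion_fullAt_SUR`, `exists_mem_unramifiedOutside_forall_resOfLe_conjH1_eq_of_SUR`) at `S₀ = Sf′`,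
the kernel of the canonical localisation (= `Sel^∅`) and additivity of coranks. -/
theorem stub_curveRelaxationCorankEq :
    Literature.NumberTheory.EllipticCurves.CastellaGrossiLeeSkinner2022.prop14_residualCharacterSelmer_finite → Literature.NumberTheory.IwasawaTheory.Greenberg2016.prop263_sur_of_crk → Literature.NumberTheory.IwasawaTheory.Greenberg2006.prop41_globalEulerPoincareCorank → Literature.NumberTheory.IwasawaTheory.Greenberg2006.prop32_cohomology_isCofinitelyGenerated →
    ∀ (W : WeierstrassCurve ℚ) [W.IsElliptic] [W.IsGloballyMinimal] (N : ℕ) [NeZero N] (K : Type) [Field K] [NumberField K], Summit.BirchSwinnertonDyer.Rank1Residual.Additive.ClassO6 W 3 → Literature.NumberTheory.EllipticCurves.Rank1Residual.Red W 3 → (∃ Φ : AddSubgroup (WeierstrassCurve.geomTorsion W ((3 : ℕ) : ℤ)), Literature.NumberTheory.EllipticCurves.Rank1Residual.IsRationalLine W 3 Φ ∧ ∀ (v : IsDedekindDomain.HeightOneSpectrum (NumberField.RingOfIntegers ℚ)), ((3 : ℕ) : NumberField.RingOfIntegers ℚ) ∈ v.asIdeal → ∀ 𝔓 ∈ v.primesAbove,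 ¬ (∀ g ∈ 𝔓.decompositionSubgroup (Field.absoluteGaloisGroup ℚ), ∀ P ∈ Φ, g • P = P) ∧ ¬ (∀ g ∈ 𝔓.decompositionSubgroup (Field.absoluteGaloisGroup ℚ), ∀ P : WeierstrassCurve.geomTorsion W ((3 : ℕ) : ℤ), g • P - P ∈ Φ)) → W.conductorNorm ℤ = N → Literature.NumberTheory.EllipticCurves.IsImaginaryQuadratic K → Literature.NumberTheory.EllipticCurves.SatisfiesHeegnerHypothesis N K → Odd (NumberField.discr K) → (∀ Q : (W.baseChange K).toAffine.Point, (3 : ℕ) • Q = 0 → Q = 0) → ∀ (κ : Literature.NumberTheory.EllipticCurves.ZpExtension K 3), κ.IsAnticyclotomic → ∀ (γ : Field.absoluteGaloisGroup K) [Fact (κ.IsTopGenerator γ)] (𝔭 : IsDedekindDomain.HeightOneSpectrum (NumberField.RingOfIntegers K)), ((3 : ℕ) : NumberField.RingOfIntegers K) ∈ 𝔭.asIdeal → 𝔭.asIdeal.ramificationIdx (NumberField.RingOfIntegers ℚ) = 1 → 𝔭.asIdeal.inertiaDeg (NumberField.RingOfIntegers ℚ) = 1 → ∀ (𝔭' :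 IsDedekindDomain.HeightOneSpectrum (NumberField.RingOfIntegers K)), ((3 : ℕ) : NumberField.RingOfIntegers K) ∈ 𝔭'.asIdeal → 𝔭' ≠ 𝔭 → ∀ (Sf' : Finset (IsDedekindDomain.HeightOneSpectrum (NumberField.RingOfIntegers K))), (∀ w : IsDedekindDomain.HeightOneSpectrum (NumberField.RingOfIntegers K), w ∈ Sf' ↔ (((W.conductorNorm ℤ : ℤ) : NumberField.RingOfIntegers K) ∈ w.asIdeal ∧ ((3 : ℕ) : NumberField.RingOfIntegers K) ∉ w.asIdeal)) → Literature.NumberTheory.EllipticCurves.zpCorank (↥(Summit.BirchSwinnertonDyer.Rank1Residual.X11b.AcSelmer.selmerAc (W.baseChange K) 3 κ 𝔭' (↑Sf' : Set (IsDedekindDomain.HeightOneSpectrum (NumberField.RingOfIntegers K)))) ⧸ (Summit.BirchSwinnertonDyer.Rank1Residual.X11b.AcSelmer.selmerAc (W.baseChange K) 3 κ 𝔭' (∅ : Set (IsDedekindDomain.HeightOneSpectrum (NumberField.RingOfIntegers K)))).addSubgroupOf (Summit.BirchSwinnertonDyer.Rank1Residual.X11b.AcSelmer.selmerAc (W.baseChange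 K) 3 κ 𝔭' (↑Sf' : Set (IsDedekindDomain.HeightOneSpectrum (NumberField.RingOfIntegers K))))) 3 = ∑ w ∈ Sf', Literature.NumberTheory.EllipticCurves.KellerYin2024.numPlacesAbove κ w * Literature.NumberTheory.EllipticCurves.zpCorank (Literature.NumberTheory.EllipticCurves.subgroupH1 (κ.kerSubgroup ⊓ Literature.NumberTheory.EllipticCurves.GreenbergSelmer.decomp w) ((W.baseChange K).geomPrimaryTorsion 3)) 3 :=
  EisensteinCharacterInvariantsAtThreeCurveRelaxation.stub_curveRelaxationCorankEq

/-- v8 STUB ALG-≥(ii), now a THEOREM (p708936, lead chl-p1 g10): the LOCAL LOWER BOUND of Greenberg–Vatsal Prop. (2.4) for `E[3^∞]`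
over `K_∞^{ac}` at the tame bad places — for every `w ∈ Sf′`, `mult_{X=(Nw)⁻¹} P̃_w(E_K) ≤ corank_{ℤ_3} H¹(K_{∞,w}, E[3^∞])` (`0` at
additive `w`; at a multiplicative `w`: `𝟙[a_w ≡ Nw (mod 3)]`, by the Tate-curve dévissage `0 → C → E[3^∞] → D → 0`,
`cd_3 Gal(K̄_w/K_{∞,w}) ≤ 1` (tree `LocalZpTowerH1Divisible`) and the unramified count; `CurveLocalTameCorank`, p708556). -/
theorem stub_curveLocalCorankGe :
    ∀ (W : WeierstrassCurve ℚ) [W.IsElliptic] [W.IsGloballyMinimal] (N : ℕ) [NeZero N] (K : Type) [Field K] [NumberField K], Summit.BirchSwinnertonDyer.Rank1Residual.Additive.ClassO6 W 3 → Literature.NumberTheory.EllipticCurves.Rank1Residual.Red W 3 → (∃ Φ : AddSubgroup (WeierstrassCurve.geomTorsion W ((3 : ℕ) : ℤ)), Literature.NumberTheory.EllipticCurves.Rank1Residual.IsRationalLine W 3 Φ ∧ ∀ (v : IsDedekindDomain.HeightOneSpectrum (NumberField.RingOfIntegers ℚ)), ((3 : ℕ) : NumberField.RingOfIntegers ℚ)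 ∈ v.asIdeal → ∀ 𝔓 ∈ v.primesAbove, ¬ (∀ g ∈ 𝔓.decompositionSubgroup (Field.absoluteGaloisGroup ℚ), ∀ P ∈ Φ, g • P = P) ∧ ¬ (∀ g ∈ 𝔓.decompositionSubgroup (Field.absoluteGaloisGroup ℚ), ∀ P : WeierstrassCurve.geomTorsion W ((3 : ℕ) : ℤ), g • P - P ∈ Φ)) → W.conductorNorm ℤ = N → Literature.NumberTheory.EllipticCurves.IsImaginaryQuadratic K → Literature.NumberTheory.EllipticCurves.SatisfiesHeegnerHypothesis N K → Odd (NumberField.discr K) → (∀ Q : (W.baseChange K).toAffine.Point, (3 : ℕ) • Q = 0 → Q = 0) → ∀ (κ : Literature.NumberTheory.EllipticCurves.ZpExtension K 3), κ.IsAnticyclotomic → ∀ (γ : Field.absoluteGaloisGroup K) [Fact (κ.IsTopGenerator γ)] (𝔭 : IsDedekindDomain.HeightOneSpectrum (NumberField.RingOfIntegers K)), ((3 : ℕ) : NumberField.RingOfIntegers K) ∈ 𝔭.asIdeal → 𝔭.asIdeal.ramificationIdx (NumberField.RingOfIntegers ℚ) = 1 → 𝔭.asIdeal.inertiaDeg (NumberField.RingOfIntegers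 ℚ) = 1 → ∀ (𝔭' : IsDedekindDomain.HeightOneSpectrum (NumberField.RingOfIntegers K)), ((3 : ℕ) : NumberField.RingOfIntegers K) ∈ 𝔭'.asIdeal → 𝔭' ≠ 𝔭 → ∀ (Sf' : Finset (IsDedekindDomain.HeightOneSpectrum (NumberField.RingOfIntegers K))), (∀ w : IsDedekindDomain.HeightOneSpectrum (NumberField.RingOfIntegers K), w ∈ Sf' ↔ (((W.conductorNorm ℤ : ℤ) : NumberField.RingOfIntegers K) ∈ w.asIdeal ∧ ((3 : ℕ) : NumberField.RingOfIntegers K) ∉ w.asIdeal)) → ∀ w ∈ Sf', (Literature.NumberTheory.EllipticCurves.GreenbergVatsal2000.eulerFactorModP (W.baseChange K) 3 w).rootMultiplicity ((w.asIdeal.absNorm : ZMod 3)⁻¹) ≤ Literature.NumberTheory.EllipticCurves.zpCorank (Literature.NumberTheory.EllipticCurves.subgroupH1 (κ.kerSubgroup ⊓ Literature.NumberTheory.EllipticCurves.GreenbergSelmer.decomp w) ((W.baseChange K).geomPrimaryTorsion 3)) 3 :=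
  EisensteinCharacterInvariantsAtThreeCurveLocalCorank.stub_curveLocalCorankGe

/-- STUB AN (HARDEST; RESEARCH — not printed at `27 ∣ N`; = crux item stmt-BirchSwinnertonDyer-24040
`EisensteinCongruenceCoreAtThree` VERBATIM), CORE form: the additive twin of
`KellerYin2024.thm222_anacong_goodLattice_of_ne_one` (CGLS Thms. 2.2.1/2.2.2 with (2.16)) on the Leopoldt cell at odd
`d_K`: for every BDP frame `L`, every Katz frame `L_φ` of the Hecke character of the 3-UNRAMIFIED member of the pair
and every index `nφ` at which `L_φ` has its first unit coefficient, `L` has a first unit coefficient at some `n` with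
`n + Σ_{w∣N} λ𝒫_w(f) = 2·nφ + Σ_{w∣N}(λ𝒫_w(θsub) + λ𝒫_w(θquot))` (binders of `han` of p614352 VERBATIM; conclusion
`∀ nφ, FirstUnitCoeffAt L_φ nφ → ∃ n, …` instead of `∃ n nφ, …` — Hida's `μ(L_φ) = 0` is [BR𝟙]'s). Content: the
Λ-adic Eisenstein congruence `ℒ_𝔭 ≡ 𝓔·L_φ·L_ψ` for the born-depleted BDP measure on `Ig(N/3^a)` (Serre–Tate CM-sum
of `f ∈ V₃(N/3^a)`), Katz's functional equation `λ(L_ψ) = λ(L_φ)`, Euler bookkeeping. -/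
theorem stub_anCongruenceCore :
    ∀ (W : WeierstrassCurve ℚ) [W.IsElliptic] [W.IsGloballyMinimal] (N : ℕ) [NeZero N] (K : Type) [Field K] [NumberField K] (Dt : Literature.NumberTheory.EllipticCurves.ModularForms.ModularParametrizationData W N), Summit.BirchSwinnertonDyer.Rank1Residual.Additive.ClassO6 W 3 → Literature.NumberTheory.EllipticCurves.Rank1Residual.Red W 3 → (∃ Φ : AddSubgroup (WeierstrassCurve.geomTorsion W ((3 : ℕ) : ℤ)), Literature.NumberTheory.EllipticCurves.Rank1Residual.IsRationalLine W 3 Φ ∧ ∀ (v : IsDedekindDomain.HeightOneSpectrum (NumberField.RingOfIntegers ℚ)), ((3 : ℕ) : NumberField.RingOfIntegers ℚ) ∈ v.asIdeal → ∀ 𝔓 ∈ v.primesAbove, ¬ (∀ g ∈ 𝔓.decompositionSubgroup (Field.absoluteGaloisGroup ℚ), ∀ P ∈ Φ, g • P = P) ∧ ¬ (∀ g ∈ 𝔓.decompositionSubgroup (Field.absoluteGaloisGroup ℚ), ∀ P : WeierstrassCurve.geomTorsion W ((3 : ℕ) : ℤ), g • P - P ∈ Φ)) → W.analyticRank = 1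 → W.conductorNorm ℤ = N → Literature.NumberTheory.EllipticCurves.IsImaginaryQuadratic K → Literature.NumberTheory.EllipticCurves.SatisfiesHeegnerHypothesis N K → Odd (NumberField.discr K) → ∀ (κ : Literature.NumberTheory.EllipticCurves.ZpExtension K 3), κ.IsAnticyclotomic → ∀ (γ : Field.absoluteGaloisGroup K) [Fact (κ.IsTopGenerator γ)] (𝔭 : IsDedekindDomain.HeightOneSpectrum (NumberField.RingOfIntegers K)), ((3 : ℕ) : NumberField.RingOfIntegers K) ∈ 𝔭.asIdeal → 𝔭.asIdeal.ramificationIdx (NumberField.RingOfIntegers ℚ) = 1 → 𝔭.asIdeal.inertiaDeg (NumberField.RingOfIntegers ℚ) = 1 → ∀ (𝔭' : IsDedekindDomain.HeightOneSpectrum (NumberField.RingOfIntegers K)), ((3 : ℕ) : NumberField.RingOfIntegers K) ∈ 𝔭'.asIdeal → 𝔭' ≠ 𝔭 → ∀ (ι' : PadicAlgCl 3 ≃+* ℂ), Summit.BirchSwinnertonDyer.BirchSwinnertonDyer.Theorems.SchneiderFree.BranchInducesPrime 3 ι' 𝔭 → ∀ (ΩK : ℂ) (Ωp : ℂ_[3])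 (L : Literature.NumberTheory.EllipticCurves.UnrSeries 3), ΩK ≠ 0 → Ωp ≠ 0 → Literature.NumberTheory.EllipticCurves.IsBDPLFunction ι' 𝔭 κ γ Dt.f ΩK Ωp L → ∀ (θsub θquot : FramedGaloisRep ℚ (padicCoeffIntegers (∅ : Set (PadicAlgCl 3))) 1), Literature.NumberTheory.EllipticCurves.KellerYin2024.IsResidualPairOver (W.baseChange K) 3 (θsub.restrictField K) (θquot.restrictField K) → ∀ (θunr : FramedGaloisRep ℚ (padicCoeffIntegers (∅ : Set (PadicAlgCl 3))) 1), (θunr = θsub ∨ θunr = θquot) → (∀ u : IsDedekindDomain.HeightOneSpectrum (NumberField.RingOfIntegers ℚ), ((3 : ℕ) : NumberField.RingOfIntegers ℚ) ∈ u.asIdeal → θunr.IsUnramifiedAt u) → ∀ (Sf : Finset (IsDedekindDomain.HeightOneSpectrum (NumberField.RingOfIntegers K))), (∀ w : IsDedekindDomain.HeightOneSpectrum (NumberField.RingOfIntegers K), w ∈ Sf ↔ ((W.conductorNorm ℤ : ℤ) : NumberField.RingOfIntegers K) ∈ w.asIdeal) → ∀ (θK : HeckeCharacter K), Literature.NumberTheory.EllipticCurves.KellerYin2024.IsHeckeCharOf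 ι' (θunr.restrictField K) θK → ∀ (Cbar : Finset (IsDedekindDomain.HeightOneSpectrum (NumberField.RingOfIntegers K))), (∀ u ∈ Cbar, ¬ θK.IsUnramifiedAt u) → ∀ (ΩK' : ℂ) (Ωp' : (Literature.NumberTheory.EllipticCurves.unrIntegers 3)ˣ) (Lφ : Literature.NumberTheory.EllipticCurves.UnrSeries 3), ΩK' ≠ 0 → Literature.NumberTheory.EllipticCurves.CastellaGrossiLeeSkinner2022.IsKatzLFunction ι' 𝔭 𝔭' Cbar κ γ θK ΩK' ((Ωp' : Literature.NumberTheory.EllipticCurves.unrIntegers 3) : ℂ_[3]) Lφ → ∀ nφ : ℕ, Literature.NumberTheory.EllipticCurves.KellerYin2024.FirstUnitCoeffAt Lφ nφ → ∃ n : ℕ, Literature.NumberTheory.EllipticCurves.KellerYin2024.FirstUnitCoeffAt L n ∧ n + ∑ w ∈ Sf, Literature.NumberTheory.EllipticCurves.KellerYin2024.curveLocalLambda κ (W.baseChange K) w = 2 * nφ + ∑ w ∈ Sf, (Literature.NumberTheory.EllipticCurves.KellerYin2024.charLocalLambda (∅ : Set (PadicAlgCl 3)) κ (θsub.restrictField K)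 w + Literature.NumberTheory.EllipticCurves.KellerYin2024.charLocalLambda (∅ : Set (PadicAlgCl 3)) κ (θquot.restrictField K) w) := by
  sorry

/-- STUB KR-PRINT (PRINT ×3, v11): the three PUBLISHED character-level / analytic facts of CGLS 2022 §2 the branches and the cut
consume, by name — Thm. 2.1.2 (Katz 1978 / Hida–Tilouine 1993 / Kriz 2016: the anticyclotomic Katz `p`-adic `L`-function of `θ_K`
exists; was conjunct (ii) of v3's `stub_printedInputs`) ∧ Thm. 1.2.2 (Rubin, Hida) + Rubin's `λ`-clause + the functional equation (2.16)
for the `ω`-partner (`thm122_fe_omegaPartner_…`, feeds BRr-λ) ∧ the `φ`-half (`thm122_charGrDual_…`, replaces v10's claim-tagged BR1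
`CharMainConjOnTree 3`: on the cell both members are in the printed regime `θ|_{G_v̄} ∉ {𝟙, ω}`,
`EisensteinCharacterInvariantsAtThreeBranchesOfPrint.charRegime_of_cell`). Closes only by formalising the prints. -/
theorem stub_katzRubinPrintedFacts :
    Literature.NumberTheory.EllipticCurves.CastellaGrossiLeeSkinner2022.thm212_exists_isKatzLFunction ∧
    Literature.NumberTheory.EllipticCurves.CastellaGrossiLeeSkinner2022.thm122_fe_omegaPartner_charGrDual_torsion_muZero_lambda_eq ∧
    Literature.NumberTheory.EllipticCurves.CastellaGrossiLeeSkinner2022.thm122_charGrDual_torsion_muZero_firstUnit_lambda_eq := by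
  sorry

/-! ## Theorems of the line -/

/-- v3 STUB PRINT `stub_printedInputs` (CGLS 2022 Prop. 14 ∧ Thm. 2.1.2; registered signature VERBATIM), now a THEOREM (v11)
modulo ALG-PRINT (i) and KR-PRINT (i): Prop. 14's finiteness clause follows IN THE KERNEL from Prop. 1.2.5's module clause
(`TeichmullerPairUnramifiedAtMult.prop14_residualCharacterSelmer_finite_of_fact`, cell `bsd-eis`), and Thm. 2.1.2 is KR-PRINT (i).
(Prop. 14 is also the route's support item stmt-26897 BY VALUE.) -/
theorem stub_printedInputs :
    Literature.NumberTheory.EllipticCurves.CastellaGrossiLeeSkinner2022.prop14_residualCharacterSelmer_finite ∧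
      Literature.NumberTheory.EllipticCurves.CastellaGrossiLeeSkinner2022.thm212_exists_isKatzLFunction :=
  ⟨TeichmullerPairUnramifiedAtMult.prop14_residualCharacterSelmer_finite_of_fact stub_algLambdaPrintedFacts.1,
    stub_katzRubinPrintedFacts.1⟩

/-- v3 STUB BRr-λ (`λ(𝔛_{θram}) = nφ`), now a THEOREM (v11) modulo STUB KR-PRINT (ii): the `ω`-partner fact BY NAME through
`EisensteinCharacterInvariantsAtThreeBranchesOfPrint.ramifiedBranchLambda_of_print` (the cell's regime clauses + strict → unramified transfer). -/
theorem stub_ramifiedBranchLambda :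
    ∀ (W : WeierstrassCurve ℚ) [W.IsElliptic] [W.IsGloballyMinimal] (N : ℕ) [NeZero N] (K : Type) [Field K] [NumberField K], Summit.BirchSwinnertonDyer.Rank1Residual.Additive.ClassO6 W 3 → Literature.NumberTheory.EllipticCurves.Rank1Residual.Red W 3 → (∃ Φ : AddSubgroup (WeierstrassCurve.geomTorsion W ((3 : ℕ) : ℤ)), Literature.NumberTheory.EllipticCurves.Rank1Residual.IsRationalLine W 3 Φ ∧ ∀ (v : IsDedekindDomain.HeightOneSpectrum (NumberField.RingOfIntegers ℚ)), ((3 : ℕ) : NumberField.RingOfIntegers ℚ) ∈ v.asIdeal → ∀ 𝔓 ∈ v.primesAbove, ¬ (∀ g ∈ 𝔓.decompositionSubgroup (Field.absoluteGaloisGroup ℚ), ∀ P ∈ Φ, g • P = P) ∧ ¬ (∀ g ∈ 𝔓.decompositionSubgroup (Field.absoluteGaloisGroup ℚ), ∀ P : WeierstrassCurve.geomTorsion W ((3 : ℕ) : ℤ), g • P - P ∈ Φ)) → W.conductorNorm ℤ = N → Literature.NumberTheory.EllipticCurves.IsImaginaryQuadratic K → Literature.NumberTheory.EllipticCurves.SatisfiesHeegnerHypothesis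 N K → Odd (NumberField.discr K) → (∀ Q : (W.baseChange K).toAffine.Point, (3 : ℕ) • Q = 0 → Q = 0) → ∀ (κ : Literature.NumberTheory.EllipticCurves.ZpExtension K 3), κ.IsAnticyclotomic → ∀ (γ : Field.absoluteGaloisGroup K) [Fact (κ.IsTopGenerator γ)] (𝔭 : IsDedekindDomain.HeightOneSpectrum (NumberField.RingOfIntegers K)), ((3 : ℕ) : NumberField.RingOfIntegers K) ∈ 𝔭.asIdeal → 𝔭.asIdeal.ramificationIdx (NumberField.RingOfIntegers ℚ) = 1 → 𝔭.asIdeal.inertiaDeg (NumberField.RingOfIntegers ℚ) = 1 → ∀ (𝔭' : IsDedekindDomain.HeightOneSpectrum (NumberField.RingOfIntegers K)), ((3 : ℕ) : NumberField.RingOfIntegers K) ∈ 𝔭'.asIdeal → 𝔭' ≠ 𝔭 → ∀ (ι' : PadicAlgCl 3 ≃+* ℂ), Summit.BirchSwinnertonDyer.BirchSwinnertonDyer.Theorems.SchneiderFree.BranchInducesPrime 3 ι' 𝔭 → ∀ (Φ : AddSubgroup (WeierstrassCurve.geomTorsion W ((3 : ℕ) : ℤ))), Literature.NumberTheory.EllipticCurves.Rank1Residual.IsRationalLine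 W 3 Φ → ∀ (θsub θquot : FramedGaloisRep ℚ (padicCoeffIntegers (∅ : Set (PadicAlgCl 3))) 1), Literature.NumberTheory.EllipticCurves.KellerYin2024.IsTeichmullerLiftOn (∅ : Set (PadicAlgCl 3)) (Φ.map (WeierstrassCurve.geomTorsion W ((3 : ℕ) : ℤ)).subtype) θsub → Literature.NumberTheory.EllipticCurves.KellerYin2024.IsTeichmullerLiftOnQuot (∅ : Set (PadicAlgCl 3)) (Φ.map (WeierstrassCurve.geomTorsion W ((3 : ℕ) : ℤ)).subtype) (WeierstrassCurve.geomTorsion W ((3 : ℕ) : ℤ)) θquot → ∀ (θunr θram : FramedGaloisRep ℚ (padicCoeffIntegers (∅ : Set (PadicAlgCl 3))) 1), ((θunr = θsub ∧ θram = θquot) ∨ (θunr = θquot ∧ θram = θsub)) → (∀ u : IsDedekindDomain.HeightOneSpectrum (NumberField.RingOfIntegers ℚ), ((3 : ℕ) : NumberField.RingOfIntegers ℚ) ∈ u.asIdeal → θunr.IsUnramifiedAt u) → ∀ (θK : HeckeCharacter K), Literature.NumberTheory.EllipticCurves.KellerYin2024.IsHeckeCharOf ι' (θunr.restrictField K) θK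 → ∀ (Cbar : Finset (IsDedekindDomain.HeightOneSpectrum (NumberField.RingOfIntegers K))), (∀ u ∈ Cbar, ¬ θK.IsUnramifiedAt u) → ∀ (ΩK' : ℂ) (Ωp' : (Literature.NumberTheory.EllipticCurves.unrIntegers 3)ˣ) (Lφ : Literature.NumberTheory.EllipticCurves.UnrSeries 3), ΩK' ≠ 0 → Literature.NumberTheory.EllipticCurves.CastellaGrossiLeeSkinner2022.IsKatzLFunction ι' 𝔭 𝔭' Cbar κ γ θK ΩK' ((Ωp' : Literature.NumberTheory.EllipticCurves.unrIntegers 3) : ℂ_[3]) Lφ → ∀ nφ : ℕ, Literature.NumberTheory.EllipticCurves.KellerYin2024.FirstUnitCoeffAt Lφ nφ → ∀ (Dram : Literature.NumberTheory.EllipticCurves.GreenbergVatsal2000.DatumDualData κ γ (Literature.NumberTheory.EllipticCurves.KellerYin2024.charModule (∅ : Set (PadicAlgCl 3)) (θram.restrictField K)) (Literature.NumberTheory.EllipticCurves.Castella2018.AcSelmer.bdpData (Literature.NumberTheory.EllipticCurves.KellerYin2024.charModule (∅ : Set (PadicAlgCl 3)) (θram.restrictField K)) 3 𝔭') ∅),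 Literature.NumberTheory.EllipticCurves.lambdaInvariant 3 Dram.X = nφ :=
  EisensteinCharacterInvariantsAtThreeBranchesOfPrint.ramifiedBranchLambda_of_print stub_katzRubinPrintedFacts.2.1


/-- v7 STUB ALG-≥ `stub_curveRelaxationCorankGe` (`Σ_{w∈Sf′} λ𝒫_w(f) ≤ corank`), now a THEOREM modulo STUB PRINT (i) ONLY (v12: the
Greenberg-free count `…CurveRelaxationOfTree.stub_curveRelaxationCorankEq_ofPrint`, p794298, summed against ALG-≥(ii) p708936 in
`…AlgLambdaOfCGLS.curveRelaxationCorankGe_ofPrint`). -/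
theorem curveRelaxationCorankGe :
    ∀ (W : WeierstrassCurve ℚ) [W.IsElliptic] [W.IsGloballyMinimal] (N : ℕ) [NeZero N] (K : Type) [Field K] [NumberField K], Summit.BirchSwinnertonDyer.Rank1Residual.Additive.ClassO6 W 3 → Literature.NumberTheory.EllipticCurves.Rank1Residual.Red W 3 → (∃ Φ : AddSubgroup (WeierstrassCurve.geomTorsion W ((3 : ℕ) : ℤ)), Literature.NumberTheory.EllipticCurves.Rank1Residual.IsRationalLine W 3 Φ ∧ ∀ (v : IsDedekindDomain.HeightOneSpectrum (NumberField.RingOfIntegers ℚ)), ((3 : ℕ) : NumberField.RingOfIntegers ℚ) ∈ v.asIdeal → ∀ 𝔓 ∈ v.primesAbove, ¬ (∀ g ∈ 𝔓.decompositionSubgroup (Field.absoluteGaloisGroup ℚ), ∀ P ∈ Φ, g • P = P) ∧ ¬ (∀ g ∈ 𝔓.decompositionSubgroup (Field.absoluteGaloisGroup ℚ), ∀ P : WeierstrassCurve.geomTorsion W ((3 : ℕ) : ℤ), g • P - P ∈ Φ)) → W.conductorNorm ℤ = N → Literature.NumberTheory.EllipticCurves.IsImaginaryQuadratic K → Literature.NumberTheory.EllipticCurves.SatisfiesHeegnerHypothesis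 N K → Odd (NumberField.discr K) → (∀ Q : (W.baseChange K).toAffine.Point, (3 : ℕ) • Q = 0 → Q = 0) → ∀ (κ : Literature.NumberTheory.EllipticCurves.ZpExtension K 3), κ.IsAnticyclotomic → ∀ (γ : Field.absoluteGaloisGroup K) [Fact (κ.IsTopGenerator γ)] (𝔭 : IsDedekindDomain.HeightOneSpectrum (NumberField.RingOfIntegers K)), ((3 : ℕ) : NumberField.RingOfIntegers K) ∈ 𝔭.asIdeal → 𝔭.asIdeal.ramificationIdx (NumberField.RingOfIntegers ℚ) = 1 → 𝔭.asIdeal.inertiaDeg (NumberField.RingOfIntegers ℚ) = 1 → ∀ (𝔭' : IsDedekindDomain.HeightOneSpectrum (NumberField.RingOfIntegers K)), ((3 : ℕ) : NumberField.RingOfIntegers K) ∈ 𝔭'.asIdeal → 𝔭' ≠ 𝔭 → ∀ (Sf' : Finset (IsDedekindDomain.HeightOneSpectrum (NumberField.RingOfIntegers K))), (∀ w : IsDedekindDomain.HeightOneSpectrum (NumberField.RingOfIntegers K), w ∈ Sf' ↔ (((W.conductorNorm ℤ : ℤ) : NumberField.RingOfIntegers K) ∈ w.asIdeal ∧ ((3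 : ℕ) : NumberField.RingOfIntegers K) ∉ w.asIdeal)) → ∑ w ∈ Sf', Literature.NumberTheory.EllipticCurves.KellerYin2024.curveLocalLambda κ (W.baseChange K) w ≤ Literature.NumberTheory.EllipticCurves.zpCorank (↥(Summit.BirchSwinnertonDyer.Rank1Residual.X11b.AcSelmer.selmerAc (W.baseChange K) 3 κ 𝔭' (↑Sf' : Set (IsDedekindDomain.HeightOneSpectrum (NumberField.RingOfIntegers K)))) ⧸ (Summit.BirchSwinnertonDyer.Rank1Residual.X11b.AcSelmer.selmerAc (W.baseChange K) 3 κ 𝔭' (∅ : Set (IsDedekindDomain.HeightOneSpectrum (NumberField.RingOfIntegers K)))).addSubgroupOf (Summit.BirchSwinnertonDyer.Rank1Residual.X11b.AcSelmer.selmerAc (W.baseChange K) 3 κ 𝔭' (↑Sf' : Set (IsDedekindDomain.HeightOneSpectrum (NumberField.RingOfIntegers K))))) 3 :=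
  EisensteinCharacterInvariantsAtThreeAlgLambdaOfCGLS.curveRelaxationCorankGe_ofPrint stub_printedInputs.1

/-- v3–v6 STUB ALG-λ `stub_algLambdaFormula` (CGLS 2022 Thm. 1.5.1's λ-formula on the Leopoldt cell, binders of `halg` VERBATIM),
now a THEOREM modulo the THREE conjuncts of v12's STUB ALG-PRINT (`…AlgLambdaOfCGLS.stub_algLambdaFormula_ofCGLS`: the Greenberg-free door
p794640 + [ALG-≥] ⟸ Prop. 14 ⟸ Prop. 1.2.5). -/
theorem stub_algLambdaFormula :
    ∀ (W : WeierstrassCurve ℚ) [W.IsElliptic] [W.IsGloballyMinimal] (N : ℕ) [NeZero N] (K : Type) [Field K] [NumberField K], Summit.BirchSwinnertonDyer.Rank1Residual.Additive.ClassO6 W 3 → Literature.NumberTheory.EllipticCurves.Rank1Residual.Red W 3 → (∃ Φ : AddSubgroup (WeierstrassCurve.geomTorsion W ((3 : ℕ) : ℤ)), Literature.NumberTheory.EllipticCurves.Rank1Residual.IsRationalLine W 3 Φ ∧ ∀ (v : IsDedekindDomain.HeightOneSpectrum (NumberField.RingOfIntegers ℚ)), ((3 : ℕ) : NumberField.RingOfIntegers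 ℚ) ∈ v.asIdeal → ∀ 𝔓 ∈ v.primesAbove, ¬ (∀ g ∈ 𝔓.decompositionSubgroup (Field.absoluteGaloisGroup ℚ), ∀ P ∈ Φ, g • P = P) ∧ ¬ (∀ g ∈ 𝔓.decompositionSubgroup (Field.absoluteGaloisGroup ℚ), ∀ P : WeierstrassCurve.geomTorsion W ((3 : ℕ) : ℤ), g • P - P ∈ Φ)) → W.conductorNorm ℤ = N → Literature.NumberTheory.EllipticCurves.IsImaginaryQuadratic K → Literature.NumberTheory.EllipticCurves.SatisfiesHeegnerHypothesis N K → Odd (NumberField.discr K) → (∀ Q : (W.baseChange K).toAffine.Point, (3 : ℕ) • Q = 0 → Q = 0) → ∀ (κ : Literature.NumberTheory.EllipticCurves.ZpExtension K 3), κ.IsAnticyclotomic → ∀ (γ : Field.absoluteGaloisGroup K) [Fact (κ.IsTopGenerator γ)] (𝔭 : IsDedekindDomain.HeightOneSpectrum (NumberField.RingOfIntegers K)), ((3 : ℕ) : NumberField.RingOfIntegers K) ∈ 𝔭.asIdeal → 𝔭.asIdeal.ramificationIdx (NumberField.RingOfIntegers ℚ) = 1 → 𝔭.asIdeal.inertiaDeg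 (NumberField.RingOfIntegers ℚ) = 1 → ∀ (𝔭' : IsDedekindDomain.HeightOneSpectrum (NumberField.RingOfIntegers K)), ((3 : ℕ) : NumberField.RingOfIntegers K) ∈ 𝔭'.asIdeal → 𝔭' ≠ 𝔭 → ∀ (θsub θquot : FramedGaloisRep K (padicCoeffIntegers (∅ : Set (PadicAlgCl 3))) 1), Literature.NumberTheory.EllipticCurves.KellerYin2024.IsResidualPairOver (W.baseChange K) 3 θsub θquot → ∀ (Sf : Finset (IsDedekindDomain.HeightOneSpectrum (NumberField.RingOfIntegers K))), (∀ w : IsDedekindDomain.HeightOneSpectrum (NumberField.RingOfIntegers K), w ∈ Sf ↔ ((W.conductorNorm ℤ : ℤ) : NumberField.RingOfIntegers K) ∈ w.asIdeal) → ∀ (Dsub : Literature.NumberTheory.EllipticCurves.GreenbergVatsal2000.DatumDualData κ γ (Literature.NumberTheory.EllipticCurves.KellerYin2024.charModule (∅ : Set (PadicAlgCl 3)) θsub) (Literature.NumberTheory.EllipticCurves.Castella2018.AcSelmer.bdpData (Literature.NumberTheory.EllipticCurves.KellerYin2024.charModule (∅ : Set (PadicAlgCl 3)) θsub) 3 𝔭')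 ∅) (Dquot : Literature.NumberTheory.EllipticCurves.GreenbergVatsal2000.DatumDualData κ γ (Literature.NumberTheory.EllipticCurves.KellerYin2024.charModule (∅ : Set (PadicAlgCl 3)) θquot) (Literature.NumberTheory.EllipticCurves.Castella2018.AcSelmer.bdpData (Literature.NumberTheory.EllipticCurves.KellerYin2024.charModule (∅ : Set (PadicAlgCl 3)) θquot) 3 𝔭') ∅),
      Literature.NumberTheory.EllipticCurves.lambdaInvariant 3 (Summit.BirchSwinnertonDyer.Rank1Residual.X11b.AcSelmer.XAc (W.baseChange K) 3 κ 𝔭' ∅ γ) + ∑ w ∈ Sf, Literature.NumberTheory.EllipticCurves.KellerYin2024.curveLocalLambda κ (W.baseChange K) w = Literature.NumberTheory.EllipticCurves.lambdaInvariant 3 Dsub.X + Literature.NumberTheory.EllipticCurves.lambdaInvariant 3 Dquot.X + ∑ w ∈ Sf, (Literature.NumberTheory.EllipticCurves.KellerYin2024.charLocalLambda (∅ : Set (PadicAlgCl 3)) κ θsub w + Literature.NumberTheory.EllipticCurves.KellerYin2024.charLocalLambda (∅ : Set (PadicAlgCl 3)) κ θquot w) :=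
  EisensteinCharacterInvariantsAtThreeAlgLambdaOfCGLS.stub_algLambdaFormula_ofCGLS stub_algLambdaPrintedFacts.1 stub_algLambdaPrintedFacts.2.1
    stub_algLambdaPrintedFacts.2.2

/-- K1's / v3's print stub P under its registered name: CGLS 2022 Prop. 14 (first conjunct of STUB PRINT). -/
theorem stub_residualCharacterSelmerFinite :
    Literature.NumberTheory.EllipticCurves.CastellaGrossiLeeSkinner2022.prop14_residualCharacterSelmer_finite :=
  stub_printedInputs.1

/-- v3's print stub F1b under its registered name: CGLS 2022 Thm. 2.1.2 (second conjunct of STUB PRINT). -/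
theorem stub_katzLFunctionExists :
    Literature.NumberTheory.EllipticCurves.CastellaGrossiLeeSkinner2022.thm212_exists_isKatzLFunction :=
  stub_printedInputs.2

/-- v4 STUB BRr-R `stub_ramifiedResidualFinite` (residual finiteness for the 3-ramified member), now a THEOREM
modulo STUB PRINT (i) = CGLS 2022 Prop. 14 (`ramifiedResidualFinite_of_print`, p687701). -/
theorem stub_ramifiedResidualFinite :
    ∀ (W : WeierstrassCurve ℚ) [W.IsElliptic] [W.IsGloballyMinimal] (N : ℕ) [NeZero N] (K : Type) [Field K] [NumberField K], Summit.BirchSwinnertonDyer.Rank1Residual.Additive.ClassO6 W 3 → Literature.NumberTheory.EllipticCurves.Rank1Residual.Red W 3 → (∃ Φ : AddSubgroup (WeierstrassCurve.geomTorsion W ((3 : ℕ) : ℤ)), Literature.NumberTheory.EllipticCurves.Rank1Residual.IsRationalLine W 3 Φ ∧ ∀ (v : IsDedekindDomain.HeightOneSpectrum (NumberField.RingOfIntegers ℚ)), ((3 : ℕ) : NumberField.RingOfIntegers ℚ) ∈ v.asIdeal → ∀ 𝔓 ∈ v.primesAbove, ¬ (∀ g ∈ 𝔓.decompositionSubgroup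 (Field.absoluteGaloisGroup ℚ), ∀ P ∈ Φ, g • P = P) ∧ ¬ (∀ g ∈ 𝔓.decompositionSubgroup (Field.absoluteGaloisGroup ℚ), ∀ P : WeierstrassCurve.geomTorsion W ((3 : ℕ) : ℤ), g • P - P ∈ Φ)) → W.conductorNorm ℤ = N → Literature.NumberTheory.EllipticCurves.IsImaginaryQuadratic K → Literature.NumberTheory.EllipticCurves.SatisfiesHeegnerHypothesis N K → Odd (NumberField.discr K) → (∀ Q : (W.baseChange K).toAffine.Point, (3 : ℕ) • Q = 0 → Q = 0) → ∀ (κ : Literature.NumberTheory.EllipticCurves.ZpExtension K 3), κ.IsAnticyclotomic → ∀ (γ : Field.absoluteGaloisGroup K) [Fact (κ.IsTopGenerator γ)] (𝔭 : IsDedekindDomain.HeightOneSpectrum (NumberField.RingOfIntegers K)), ((3 : ℕ) : NumberField.RingOfIntegers K) ∈ 𝔭.asIdeal → 𝔭.asIdeal.ramificationIdx (NumberField.RingOfIntegers ℚ) = 1 → 𝔭.asIdeal.inertiaDeg (NumberField.RingOfIntegers ℚ) = 1 → ∀ (𝔭' : IsDedekindDomain.HeightOneSpectrum (NumberField.RingOfIntegers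 K)), ((3 : ℕ) : NumberField.RingOfIntegers K) ∈ 𝔭'.asIdeal → 𝔭' ≠ 𝔭 → ∀ (ι' : PadicAlgCl 3 ≃+* ℂ), Summit.BirchSwinnertonDyer.BirchSwinnertonDyer.Theorems.SchneiderFree.BranchInducesPrime 3 ι' 𝔭 → ∀ (Φ : AddSubgroup (WeierstrassCurve.geomTorsion W ((3 : ℕ) : ℤ))), Literature.NumberTheory.EllipticCurves.Rank1Residual.IsRationalLine W 3 Φ → ∀ (θsub θquot : FramedGaloisRep ℚ (padicCoeffIntegers (∅ : Set (PadicAlgCl 3))) 1), Literature.NumberTheory.EllipticCurves.KellerYin2024.IsTeichmullerLiftOn (∅ : Set (PadicAlgCl 3)) (Φ.map (WeierstrassCurve.geomTorsion W ((3 : ℕ) : ℤ)).subtype) θsub → Literature.NumberTheory.EllipticCurves.KellerYin2024.IsTeichmullerLiftOnQuot (∅ : Set (PadicAlgCl 3)) (Φ.map (WeierstrassCurve.geomTorsion W ((3 : ℕ) : ℤ)).subtype) (WeierstrassCurve.geomTorsion W ((3 : ℕ) : ℤ)) θquot → ∀ (θunr θram : FramedGaloisRep ℚ (padicCoeffIntegers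 (∅ : Set (PadicAlgCl 3))) 1), ((θunr = θsub ∧ θram = θquot) ∨ (θunr = θquot ∧ θram = θsub)) → (∀ u : IsDedekindDomain.HeightOneSpectrum (NumberField.RingOfIntegers ℚ), ((3 : ℕ) : NumberField.RingOfIntegers ℚ) ∈ u.asIdeal → θunr.IsUnramifiedAt u) → Set.Finite {s : Literature.NumberTheory.EllipticCurves.KellerYin2024.unrSelmer κ (Literature.NumberTheory.EllipticCurves.KellerYin2024.charModule (∅ : Set (PadicAlgCl 3)) (θram.restrictField K)) 𝔭' (∅ : Set (IsDedekindDomain.HeightOneSpectrum (NumberField.RingOfIntegers K))) | (3 : ℕ) • s = 0} :=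
  EisensteinCharacterInvariantsAtThreeRamifiedResidual.ramifiedResidualFinite_of_print stub_residualCharacterSelmerFinite

/-- v3 STUB BRr `stub_ramifiedBranch` (binder type `hram` of p614352), now a THEOREM modulo BRr-R and BRr-λ
(`EisensteinCharacterInvariantsAtThreeRamifiedSplit.ramifiedBranch_of_residualFinite_of_lambda`; f.g./torsion/`μ = 0`
by Greenberg's criterion p685753). -/
theorem stub_ramifiedBranch :
    ∀ (W : WeierstrassCurve ℚ) [W.IsElliptic] [W.IsGloballyMinimal] (N : ℕ) [NeZero N] (K : Type) [Field K] [NumberField K], Summit.BirchSwinnertonDyer.Rank1Residual.Additive.ClassO6 W 3 → Literature.NumberTheory.EllipticCurves.Rank1Residual.Red W 3 → (∃ Φ : AddSubgroup (WeierstrassCurve.geomTorsion W ((3 : ℕ) : ℤ)), Literature.NumberTheory.EllipticCurves.Rank1Residual.IsRationalLine W 3 Φ ∧ ∀ (v : IsDedekindDomain.HeightOneSpectrum (NumberField.RingOfIntegers ℚ)), ((3 : ℕ) : NumberField.RingOfIntegers ℚ) ∈ v.asIdeal → ∀ 𝔓 ∈ v.primesAbove, ¬ (∀ g ∈ 𝔓.decompositionSubgroup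 (Field.absoluteGaloisGroup ℚ), ∀ P ∈ Φ, g • P = P) ∧ ¬ (∀ g ∈ 𝔓.decompositionSubgroup (Field.absoluteGaloisGroup ℚ), ∀ P : WeierstrassCurve.geomTorsion W ((3 : ℕ) : ℤ), g • P - P ∈ Φ)) → W.conductorNorm ℤ = N → Literature.NumberTheory.EllipticCurves.IsImaginaryQuadratic K → Literature.NumberTheory.EllipticCurves.SatisfiesHeegnerHypothesis N K → Odd (NumberField.discr K) → (∀ Q : (W.baseChange K).toAffine.Point, (3 : ℕ) • Q = 0 → Q = 0) → ∀ (κ : Literature.NumberTheory.EllipticCurves.ZpExtension K 3), κ.IsAnticyclotomic → ∀ (γ : Field.absoluteGaloisGroup K) [Fact (κ.IsTopGenerator γ)] (𝔭 : IsDedekindDomain.HeightOneSpectrum (NumberField.RingOfIntegers K)), ((3 : ℕ) : NumberField.RingOfIntegers K) ∈ 𝔭.asIdeal → 𝔭.asIdeal.ramificationIdx (NumberField.RingOfIntegers ℚ) = 1 → 𝔭.asIdeal.inertiaDeg (NumberField.RingOfIntegers ℚ) = 1 → ∀ (𝔭' : IsDedekindDomain.HeightOneSpectrum (NumberField.RingOfIntegers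 K)), ((3 : ℕ) : NumberField.RingOfIntegers K) ∈ 𝔭'.asIdeal → 𝔭' ≠ 𝔭 → ∀ (ι' : PadicAlgCl 3 ≃+* ℂ), Summit.BirchSwinnertonDyer.BirchSwinnertonDyer.Theorems.SchneiderFree.BranchInducesPrime 3 ι' 𝔭 → ∀ (Φ : AddSubgroup (WeierstrassCurve.geomTorsion W ((3 : ℕ) : ℤ))), Literature.NumberTheory.EllipticCurves.Rank1Residual.IsRationalLine W 3 Φ → ∀ (θsub θquot : FramedGaloisRep ℚ (padicCoeffIntegers (∅ : Set (PadicAlgCl 3))) 1), Literature.NumberTheory.EllipticCurves.KellerYin2024.IsTeichmullerLiftOn (∅ : Set (PadicAlgCl 3)) (Φ.map (WeierstrassCurve.geomTorsion W ((3 : ℕ) : ℤ)).subtype) θsub → Literature.NumberTheory.EllipticCurves.KellerYin2024.IsTeichmullerLiftOnQuot (∅ : Set (PadicAlgCl 3)) (Φ.map (WeierstrassCurve.geomTorsion W ((3 : ℕ) : ℤ)).subtype) (WeierstrassCurve.geomTorsion W ((3 : ℕ) : ℤ)) θquot → ∀ (θunr θram : FramedGaloisRep ℚ (padicCoeffIntegers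 (∅ : Set (PadicAlgCl 3))) 1), ((θunr = θsub ∧ θram = θquot) ∨ (θunr = θquot ∧ θram = θsub)) → (∀ u : IsDedekindDomain.HeightOneSpectrum (NumberField.RingOfIntegers ℚ), ((3 : ℕ) : NumberField.RingOfIntegers ℚ) ∈ u.asIdeal → θunr.IsUnramifiedAt u) → ∀ (θK : HeckeCharacter K), Literature.NumberTheory.EllipticCurves.KellerYin2024.IsHeckeCharOf ι' (θunr.restrictField K) θK → ∀ (Cbar : Finset (IsDedekindDomain.HeightOneSpectrum (NumberField.RingOfIntegers K))), (∀ u ∈ Cbar, ¬ θK.IsUnramifiedAt u) → ∀ (ΩK' : ℂ) (Ωp' : (Literature.NumberTheory.EllipticCurves.unrIntegers 3)ˣ) (Lφ : Literature.NumberTheory.EllipticCurves.UnrSeries 3), ΩK' ≠ 0 → Literature.NumberTheory.EllipticCurves.CastellaGrossiLeeSkinner2022.IsKatzLFunction ι' 𝔭 𝔭' Cbar κ γ θK ΩK' ((Ωp' : Literature.NumberTheory.EllipticCurves.unrIntegers 3) : ℂ_[3]) Lφ → ∀ nφ : ℕ, Literature.NumberTheory.EllipticCurves.KellerYin2024.FirstUnitCoeffAt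 Lφ nφ → ∀ (Dram : Literature.NumberTheory.EllipticCurves.GreenbergVatsal2000.DatumDualData κ γ (Literature.NumberTheory.EllipticCurves.KellerYin2024.charModule (∅ : Set (PadicAlgCl 3)) (θram.restrictField K)) (Literature.NumberTheory.EllipticCurves.Castella2018.AcSelmer.bdpData (Literature.NumberTheory.EllipticCurves.KellerYin2024.charModule (∅ : Set (PadicAlgCl 3)) (θram.restrictField K)) 3 𝔭') ∅), Module.Finite (Literature.NumberTheory.EllipticCurves.IwasawaAlgebra 3) Dram.X ∧ Module.IsTorsion (Literature.NumberTheory.EllipticCurves.IwasawaAlgebra 3) Dram.X ∧ Literature.NumberTheory.EllipticCurves.muInvariant 3 Dram.X = 0 ∧ Literature.NumberTheory.EllipticCurves.lambdaInvariant 3 Dram.X = nφ :=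
  EisensteinCharacterInvariantsAtThreeRamifiedSplit.ramifiedBranch_of_residualFinite_of_lambda
    stub_ramifiedResidualFinite stub_ramifiedBranchLambda

/-- [F1b] at `p = 3` in K5's currency (`X1.KellerYinMuLambdaSplit.KatzLFunctionExistsFor 3`) — the print stub read
binder for binder (cf. `EisensteinPrimesMuLambda.katzLFunctionExistsFor_of_thm212`). -/
theorem katzLFunctionExistsFor_three :
    Summit.BirchSwinnertonDyer.Rank1Residual.X1.KellerYinMuLambdaSplit.KatzLFunctionExistsFor 3 :=
  stub_katzLFunctionExists 3

/-- v2 STUB ALG `stub_algLambda` (the full `halg` binder type of p614352), now a THEOREM modulo STUB P and the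
λ-formula stub (p684853: f.g. / torsion / `μ = 0` from B1). -/
theorem stub_algLambda :
    ∀ (W : WeierstrassCurve ℚ) [W.IsElliptic] [W.IsGloballyMinimal] (N : ℕ) [NeZero N] (K : Type) [Field K] [NumberField K], Summit.BirchSwinnertonDyer.Rank1Residual.Additive.ClassO6 W 3 → Literature.NumberTheory.EllipticCurves.Rank1Residual.Red W 3 → (∃ Φ : AddSubgroup (WeierstrassCurve.geomTorsion W ((3 : ℕ) : ℤ)), Literature.NumberTheory.EllipticCurves.Rank1Residual.IsRationalLine W 3 Φ ∧ ∀ (v : IsDedekindDomain.HeightOneSpectrum (NumberField.RingOfIntegers ℚ)), ((3 : ℕ) : NumberField.RingOfIntegers ℚ) ∈ v.asIdeal → ∀ 𝔓 ∈ v.primesAbove, ¬ (∀ g ∈ 𝔓.decompositionSubgroup (Field.absoluteGaloisGroup ℚ), ∀ P ∈ Φ, g • P = P) ∧ ¬ (∀ g ∈ 𝔓.decompositionSubgroup (Field.absoluteGaloisGroup ℚ), ∀ P : WeierstrassCurve.geomTorsion W ((3 : ℕ) : ℤ), g • P - P ∈ Φ)) → W.conductorNorm ℤ = N → Literature.NumberTheory.EllipticCurves.IsImaginaryQuadratic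 K → Literature.NumberTheory.EllipticCurves.SatisfiesHeegnerHypothesis N K → Odd (NumberField.discr K) → (∀ Q : (W.baseChange K).toAffine.Point, (3 : ℕ) • Q = 0 → Q = 0) → ∀ (κ : Literature.NumberTheory.EllipticCurves.ZpExtension K 3), κ.IsAnticyclotomic → ∀ (γ : Field.absoluteGaloisGroup K) [Fact (κ.IsTopGenerator γ)] (𝔭 : IsDedekindDomain.HeightOneSpectrum (NumberField.RingOfIntegers K)), ((3 : ℕ) : NumberField.RingOfIntegers K) ∈ 𝔭.asIdeal → 𝔭.asIdeal.ramificationIdx (NumberField.RingOfIntegers ℚ) = 1 → 𝔭.asIdeal.inertiaDeg (NumberField.RingOfIntegers ℚ) = 1 → ∀ (𝔭' : IsDedekindDomain.HeightOneSpectrum (NumberField.RingOfIntegers K)), ((3 : ℕ) : NumberField.RingOfIntegers K) ∈ 𝔭'.asIdeal → 𝔭' ≠ 𝔭 → ∀ (θsub θquot : FramedGaloisRep K (padicCoeffIntegers (∅ : Set (PadicAlgCl 3))) 1), Literature.NumberTheory.EllipticCurves.KellerYin2024.IsResidualPairOver (W.baseChange K) 3 θsub θquot → ∀ (Sf : Finset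 (IsDedekindDomain.HeightOneSpectrum (NumberField.RingOfIntegers K))), (∀ w : IsDedekindDomain.HeightOneSpectrum (NumberField.RingOfIntegers K), w ∈ Sf ↔ ((W.conductorNorm ℤ : ℤ) : NumberField.RingOfIntegers K) ∈ w.asIdeal) → ∀ (Dsub : Literature.NumberTheory.EllipticCurves.GreenbergVatsal2000.DatumDualData κ γ (Literature.NumberTheory.EllipticCurves.KellerYin2024.charModule (∅ : Set (PadicAlgCl 3)) θsub) (Literature.NumberTheory.EllipticCurves.Castella2018.AcSelmer.bdpData (Literature.NumberTheory.EllipticCurves.KellerYin2024.charModule (∅ : Set (PadicAlgCl 3)) θsub) 3 𝔭') ∅) (Dquot : Literature.NumberTheory.EllipticCurves.GreenbergVatsal2000.DatumDualData κ γ (Literature.NumberTheory.EllipticCurves.KellerYin2024.charModule (∅ : Set (PadicAlgCl 3)) θquot) (Literature.NumberTheory.EllipticCurves.Castella2018.AcSelmer.bdpData (Literature.NumberTheory.EllipticCurves.KellerYin2024.charModule (∅ : Set (PadicAlgCl 3)) θquot) 3 𝔭') ∅), Module.Finite (Literature.NumberTheory.EllipticCurves.IwasawaAlgebra 3) (Summit.BirchSwinnertonDyer.Rank1Residual.X11b.AcSelmer.XAc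 (W.baseChange K) 3 κ 𝔭' ∅ γ) ∧ Module.IsTorsion (Literature.NumberTheory.EllipticCurves.IwasawaAlgebra 3) (Summit.BirchSwinnertonDyer.Rank1Residual.X11b.AcSelmer.XAc (W.baseChange K) 3 κ 𝔭' ∅ γ) ∧ Literature.NumberTheory.EllipticCurves.muInvariant 3 (Summit.BirchSwinnertonDyer.Rank1Residual.X11b.AcSelmer.XAc (W.baseChange K) 3 κ 𝔭' ∅ γ) = 0 ∧ Literature.NumberTheory.EllipticCurves.lambdaInvariant 3 (Summit.BirchSwinnertonDyer.Rank1Residual.X11b.AcSelmer.XAc (W.baseChange K) 3 κ 𝔭' ∅ γ) + ∑ w ∈ Sf, Literature.NumberTheory.EllipticCurves.KellerYin2024.curveLocalLambda κ (W.baseChange K) w = Literature.NumberTheory.EllipticCurves.lambdaInvariant 3 Dsub.X + Literature.NumberTheory.EllipticCurves.lambdaInvariant 3 Dquot.X + ∑ w ∈ Sf, (Literature.NumberTheory.EllipticCurves.KellerYin2024.charLocalLambda (∅ : Set (PadicAlgCl 3)) κ θsub w + Literature.NumberTheory.EllipticCurves.KellerYin2024.charLocalLambda (∅ : Set (PadicAlgCl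 3)) κ θquot w) :=
  EisensteinCharacterInvariantsAtThreeAlgSplit.algLambda_of_print_of_formula stub_residualCharacterSelmerFinite
    stub_algLambdaFormula

/-- v1 STUB A, now a THEOREM modulo STUB P (registered signature VERBATIM): at every BDP frame of the Leopoldt cell
`Ch_Λ(X_{∅,0}(𝔭′))·R₀⟦T⟧ = (g)` with `g` having its first unit coefficient at some `n` (`μ_alg = 0`, `λ_alg = n`).
Proof: P ⟹ B1 (closed item 26898, p616187) ⟹ A (p609299), packaged as p680949. -/
theorem stub_algebraicLambdaMuZero :
    ∀ (W : WeierstrassCurve ℚ) [W.IsElliptic] [W.IsGloballyMinimal] (N : ℕ) [NeZero N] (K : Type) [Field K] [NumberField K] (Dt : Literature.NumberTheory.EllipticCurves.ModularForms.ModularParametrizationData W N), Summit.BirchSwinnertonDyer.Rank1Residual.Additive.ClassO6 W 3 → Literature.NumberTheory.EllipticCurves.Rank1Residual.Red W 3 → (∃ Φ : AddSubgroup (WeierstrassCurve.geomTorsion W ((3 : ℕ) : ℤ)), Literature.NumberTheory.EllipticCurves.Rank1Residual.IsRationalLine W 3 Φ ∧ ∀ (v : IsDedekindDomain.HeightOneSpectrum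 (NumberField.RingOfIntegers ℚ)), ((3 : ℕ) : NumberField.RingOfIntegers ℚ) ∈ v.asIdeal → ∀ 𝔓 ∈ v.primesAbove, ¬ (∀ g ∈ 𝔓.decompositionSubgroup (Field.absoluteGaloisGroup ℚ), ∀ P ∈ Φ, g • P = P) ∧ ¬ (∀ g ∈ 𝔓.decompositionSubgroup (Field.absoluteGaloisGroup ℚ), ∀ P : WeierstrassCurve.geomTorsion W ((3 : ℕ) : ℤ), g • P - P ∈ Φ)) → W.analyticRank = 1 → W.conductorNorm ℤ = N → Literature.NumberTheory.EllipticCurves.IsImaginaryQuadratic K → Literature.NumberTheory.EllipticCurves.SatisfiesHeegnerHypothesis N K → ∀ (κ : Literature.NumberTheory.EllipticCurves.ZpExtension K 3), κ.IsAnticyclotomic → ∀ (γ : Field.absoluteGaloisGroup K) [Fact (κ.IsTopGenerator γ)] (𝔭 : IsDedekindDomain.HeightOneSpectrum (NumberField.RingOfIntegers K)), ((3 : ℕ) : NumberField.RingOfIntegers K) ∈ 𝔭.asIdeal → 𝔭.asIdeal.ramificationIdx (NumberField.RingOfIntegers ℚ) = 1 → 𝔭.asIdeal.inertiaDeg (NumberField.RingOfIntegers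 ℚ) = 1 → ∀ (𝔭' : IsDedekindDomain.HeightOneSpectrum (NumberField.RingOfIntegers K)), ((3 : ℕ) : NumberField.RingOfIntegers K) ∈ 𝔭'.asIdeal → 𝔭' ≠ 𝔭 → ∀ (ι' : PadicAlgCl 3 ≃+* ℂ), Summit.BirchSwinnertonDyer.BirchSwinnertonDyer.Theorems.SchneiderFree.BranchInducesPrime 3 ι' 𝔭 → ∀ (ΩK : ℂ) (Ωp : ℂ_[3]) (L : Literature.NumberTheory.EllipticCurves.UnrSeries 3), ΩK ≠ 0 → Ωp ≠ 0 → Literature.NumberTheory.EllipticCurves.IsBDPLFunction ι' 𝔭 κ γ Dt.f ΩK Ωp L → ∃ (g : Literature.NumberTheory.EllipticCurves.UnrSeries 3) (n : ℕ), (Summit.BirchSwinnertonDyer.Rank1Residual.X11b.AcSelmer.XAc.charIdeal (W.baseChange K) 3 κ 𝔭' ∅ γ).map (PowerSeries.map (Summit.BirchSwinnertonDyer.Rank1Residual.X11b.Halves.toUnr 3)) = Ideal.span {g} ∧ (∀ i < n, ‖((PowerSeries.coeff i g : Literature.NumberTheory.EllipticCurves.unrIntegers 3) : ℂ_[3])‖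 < 1) ∧ ‖((PowerSeries.coeff n g : Literature.NumberTheory.EllipticCurves.unrIntegers 3) : ℂ_[3])‖ = 1 :=
  EisensteinCharacterInvariantsAtThreeAlgebraicHalf.stub_algebraicLambdaMuZero_of_print stub_residualCharacterSelmerFinite

/-- **K2 at odd `d_K`** (the crux with `Odd (NumberField.discr K) →` inserted after the Heegner hypothesis) from the
stubs P, ALG, AN, BRr, KR-PRINT, F1b through the sharpened character cut p681722 in its core form with [BR𝟙] from print (v11,
`EisensteinCharacterInvariantsAtThreeCharacterCutCoreOfPrint.eisensteinCharacterInvariantsAtThree_odd_of_print_of_characterCutCore_of_print`),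
with [LOC₃] supplied by the tree theorem `EisensteinCharacterInvariantsAtThreeLocThree.isUnramifiedAt_three_sub_or_quot`
(p682321) and [TOR] by `EisensteinCharacterInvariantsAtThreeCellTorsion.cell_noThreeTorsion_rational` (p681358, used
inside the cut). -/
theorem eisensteinCharacterInvariantsAtThree_odd :
    ∀ (W : WeierstrassCurve ℚ) [W.IsElliptic] [W.IsGloballyMinimal] (N : ℕ) [NeZero N] (K : Type) [Field K] [NumberField K] (Dt : Literature.NumberTheory.EllipticCurves.ModularForms.ModularParametrizationData W N), Summit.BirchSwinnertonDyer.Rank1Residual.Additive.ClassO6 W 3 → Literature.NumberTheory.EllipticCurves.Rank1Residual.Red W 3 → (∃ Φ : AddSubgroup (WeierstrassCurve.geomTorsion W ((3 : ℕ) : ℤ)), Literature.NumberTheory.EllipticCurves.Rank1Residual.IsRationalLine W 3 Φ ∧ ∀ (v : IsDedekindDomain.HeightOneSpectrum (NumberField.RingOfIntegers ℚ)), ((3 : ℕ) : NumberField.RingOfIntegers ℚ) ∈ v.asIdeal → ∀ 𝔓 ∈ v.primesAbove, ¬ (∀ g ∈ 𝔓.decompositionSubgroup (Field.absoluteGaloisGroup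 ℚ), ∀ P ∈ Φ, g • P = P) ∧ ¬ (∀ g ∈ 𝔓.decompositionSubgroup (Field.absoluteGaloisGroup ℚ), ∀ P : WeierstrassCurve.geomTorsion W ((3 : ℕ) : ℤ), g • P - P ∈ Φ)) → W.analyticRank = 1 → W.conductorNorm ℤ = N → Literature.NumberTheory.EllipticCurves.IsImaginaryQuadratic K → Literature.NumberTheory.EllipticCurves.SatisfiesHeegnerHypothesis N K → Odd (NumberField.discr K) → ∀ (κ : Literature.NumberTheory.EllipticCurves.ZpExtension K 3), κ.IsAnticyclotomic → ∀ (γ : Field.absoluteGaloisGroup K) [Fact (κ.IsTopGenerator γ)] (𝔭 : IsDedekindDomain.HeightOneSpectrum (NumberField.RingOfIntegers K)), ((3 : ℕ) : NumberField.RingOfIntegers K) ∈ 𝔭.asIdeal → 𝔭.asIdeal.ramificationIdx (NumberField.RingOfIntegers ℚ) = 1 → 𝔭.asIdeal.inertiaDeg (NumberField.RingOfIntegers ℚ) = 1 → ∀ (𝔭' : IsDedekindDomain.HeightOneSpectrum (NumberField.RingOfIntegers K)), ((3 : ℕ) : NumberField.RingOfIntegers K) ∈ 𝔭'.asIdeal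 → 𝔭' ≠ 𝔭 → ∀ (ι' : PadicAlgCl 3 ≃+* ℂ), Summit.BirchSwinnertonDyer.BirchSwinnertonDyer.Theorems.SchneiderFree.BranchInducesPrime 3 ι' 𝔭 → ∀ (ΩK : ℂ) (Ωp : ℂ_[3]) (L : Literature.NumberTheory.EllipticCurves.UnrSeries 3), ΩK ≠ 0 → Ωp ≠ 0 → Literature.NumberTheory.EllipticCurves.IsBDPLFunction ι' 𝔭 κ γ Dt.f ΩK Ωp L → ∃ (g : Literature.NumberTheory.EllipticCurves.UnrSeries 3) (n : ℕ), (Summit.BirchSwinnertonDyer.Rank1Residual.X11b.AcSelmer.XAc.charIdeal (W.baseChange K) 3 κ 𝔭' ∅ γ).map (PowerSeries.map (Summit.BirchSwinnertonDyer.Rank1Residual.X11b.Halves.toUnr 3)) = Ideal.span {g} ∧ (∀ i < n, ‖((PowerSeries.coeff i g : Literature.NumberTheory.EllipticCurves.unrIntegers 3) : ℂ_[3])‖ < 1) ∧ ‖((PowerSeries.coeff n g : Literature.NumberTheory.EllipticCurves.unrIntegers 3) : ℂ_[3])‖ = 1 ∧ (∀ i < n, ‖((PowerSeries.coeff i L :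 Literature.NumberTheory.EllipticCurves.unrIntegers 3) : ℂ_[3])‖ < 1) ∧ ‖((PowerSeries.coeff n L : Literature.NumberTheory.EllipticCurves.unrIntegers 3) : ℂ_[3])‖ = 1 :=
  EisensteinCharacterInvariantsAtThreeCharacterCutCoreOfPrint.eisensteinCharacterInvariantsAtThree_odd_of_print_of_characterCutCore_of_print
    stub_residualCharacterSelmerFinite EisensteinCharacterInvariantsAtThreeLocThree.isUnramifiedAt_three_sub_or_quot
    stub_algLambda stub_anCongruenceCore stub_ramifiedBranch stub_katzRubinPrintedFacts.2.2 katzLFunctionExistsFor_three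

/-- COMPOSITION (line `birth` v6, kernel-checked): the registered stubs ⟹ the route crux
`EisensteinCharacterInvariantsAtThreeOdd` BY NAME — the odd-`d_K` character cut `eisensteinCharacterInvariantsAtThree_odd`
IS the restated crux, binder for binder. -/
theorem EisensteinCharacterInvariantsAtThreeOdd_of :
    Summit.BirchSwinnertonDyer.BirchSwinnertonDyer.Theses.CumulativeHeegnerLeopoldt.EisensteinCharacterInvariantsAtThreeOdd :=
  eisensteinCharacterInvariantsAtThree_odd

end Summit.BirchSwinnertonDyer.BirchSwinnertonDyer.Cruxes.EisensteinCharacterInvariantsAtThreeOdd.Birth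

end
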